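import Mathlib
import Summits.NavierStokesRegularity.NavierStokesRegularity.Theorems.FilamentSkeletonRssSkeletonJ1RLiaDefectDerivSplit
import Summits.NavierStokesRegularity.NavierStokesRegularity.Theorems.FilamentSkeletonRssClause13TraceIdentity
import Summits.NavierStokesRegularity.NavierStokesRegularity.Theorems.FilamentSkeletonRssSkeletonJ1RLiaLipschitzTools

/-!
# Crux `SkeletonJ1R` (stmt-NavierStokesRegularity-23610) · line `streamline_kantorovich_R` · toward stub F2-d (`LiaDefectDerivBL`, v7):
# THE DERIVATIVE OF THE SWITCHED NORMAL DEFECT ALONG A UNIT-SPEED REFERENCE — REFERENCE FORM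

Lead `ns-fsr-lead-23610` g2, `--supports stmt-NavierStokesRegularity-23610 --as helper`.  MODEL rung, NEGATIVE side of the ladder: calculus for a
HYPOTHETICAL filament-type blow-up skeleton; nothing here is a claim about Navier–Stokes regularity; the stub and the crux stay OPEN.

WHY.  `…LiaDefectDerivSplit.swDefect_hasDerivAt_param` gives the derivative of `τ ↦ swDefect Γ Rb γ α M x j τ` for general `C²` filaments as the raw
quotient-rule expression.  Along a UNIT-SPEED reference about which the model is the SLICED arm model (`M (x_j τ) = (7/4)τ · x_j′ τ`, tangent), it
collapses to the form the F2-d bound will actually estimate: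
`D′ = σ′ · (V₀ − ⟪V₀,P⟫P) + σ₀ · (V′ − ⟪V′,P⟫P − ⟪V₀,P′⟫P − ⟪V₀,P⟫P′)`,
`P = x_j′ τ`, `P′ = x_j″ τ` (`‖P‖ = 1`, `⟪P,P′⟫ = 0`), `σ₀ = switchWeight ℓ 1 (x_j τ)`, `σ′` its derivative along the reference (explicit scalar), `V₀ = trueField x (x_j τ)`,
`V′ = D(trueField x)(x_j τ)·P` (explicit: `…LiaDefectDerivSplit.trueField_fderiv_apply`) — the model drops out entirely.  So on the collar `ℓ‖D′‖` is controlled by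
(i) `ℓ|σ′| ≤ 2√2·sup|smoothTransition′|` times the UNSWITCHED normal defect `‖V₀ − ⟪V₀,P⟫P‖` (the F2-B pieces), and (ii) the new quantity
`‖P^⊥V′ − ⟪V₀,P′⟫P − ⟪V₀,P⟫P′‖` (derivative of the strand residuals along the reference; tangential slip × curvature).
* `hasDerivAt_perp_unitSpeed` — abstract: `(W − ⟪W,P⟫P)′ = W′ − ⟪W′,P⟫P − ⟪W,P′⟫P − ⟪W,P⟫P′` when `‖P‖ = 1`, `⟪P,P′⟫ = 0`;
* `hasDerivAt_slicedModel_ref` — `τ ↦ M (x_j τ)` has derivative `(7/4)P + ((7/4)τ)P′` along the reference;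
* `swDefect_hasDerivAt_ref` — the reference form above (hypotheses: unit-speed `C²` proper filaments, sliced model at `λ`, `0 ≤ ρ√Γ`);
* `abs_deriv_smoothTransition_le`, `abs_switchWeight_deriv_le` — `∃ Cφ ≥ 0` universal with `|σ′| · ℓ ≤ 2√2·Cφ` whenever `‖x_j τ‖² ≤ 2ℓ²`, `ℓ > 0`.
-/

set_option linter.dupNamespace false -- `NavierStokesRegularity.NavierStokesRegularity` path/namespace repetition is the tree convention

noncomputable section

namespace Summit.NavierStokesRegularity.NavierStokesRegularity.Theorems.SkeletonJ1RFrame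

open Set Function Filter MeasureTheory Real Topology
open Literature.Analysis.FluidPDE
open Summit.NavierStokesRegularity.NavierStokesRegularity.Theorems.MatchedKernel
open Summit.NavierStokesRegularity.NavierStokesRegularity.Theorems.SkeletonJ1RLiaSelf (contDiff_one_deriv)
open scoped InnerProductSpace BigOperators

/-! ## §1 Abstract: the normal part along a unit-speed frame -/

/-- **Derivative of the normal part `W − ⟪W,P⟫P` when `‖P‖ = 1` and `⟪P, P′⟫ = 0`** (unit-speed curves): `W′ − ⟪W′,P⟫P − ⟪W,P′⟫P − ⟪W,P⟫P′`. [folklore] -/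
theorem hasDerivAt_perp_unitSpeed {W P : ℝ → EuclideanSpace ℝ (Fin 3)} {W' P' : EuclideanSpace ℝ (Fin 3)} {s : ℝ}
    (hW : HasDerivAt W W' s) (hP : HasDerivAt P P' s) (hP1 : ‖P s‖ = 1) (hPP' : ⟪P s, P'⟫_ℝ = 0) :
    HasDerivAt (fun s => W s - (⟪W s, P s⟫_ℝ / ‖P s‖ ^ 2) • P s)
      (W' - ⟪W', P s⟫_ℝ • P s - ⟪W s, P'⟫_ℝ • P s - ⟪W s, P s⟫_ℝ • P') s := by
  have hP0 : P s ≠ 0 := by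
    intro h; rw [h, norm_zero] at hP1; exact zero_ne_one hP1
  have h := hasDerivAt_tangencyDefect hW hP hP0
  refine h.congr_deriv ?_
  rw [hP1, hPP']
  simp only [one_pow, mul_one, div_one, mul_zero, sub_zero, add_smul]
  abel

/-! ## §2 The sliced model along the reference -/

variable {N : ℕ} {Γ ρ lam α c C : ℝ} {γ : Fin N → ℝ} {t : Fin N → EuclideanSpace ℝ (Fin 3)} {x : Fin N → ℝ → EuclideanSpace ℝ (Fin 3)}
  {M : EuclideanSpace ℝ (Fin 3) → EuclideanSpace ℝ (Fin 3)}

/-- Along the reference the sliced model IS `(7/4)τ · x_j′ τ`, hence `τ ↦ M (x_j τ)` has derivative `(7/4)•x_j′ τ + ((7/4)τ)•x_j″ τ`. [folklore] -/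
theorem hasDerivAt_slicedModel_ref (hM : SlicedModel Γ ρ lam t x M) (hρΓ : 0 ≤ ρ * Real.sqrt Γ) (hx : ∀ k, ContDiff ℝ 2 (x k))
    (j : Fin N) (τ : ℝ) :
    HasDerivAt (fun τ' => M (x j τ')) ((7/4:ℝ) • deriv (x j) τ + ((7/4:ℝ) * τ) • deriv (deriv (x j)) τ) τ := by
  have heq : (fun τ' => M (x j τ')) = fun τ' => ((7/4:ℝ) * τ') • deriv (x j) τ' :=
    funext fun τ' => hM.apply_ref hρΓ j τ'
  rw [heq]
  have hPt : HasDerivAt (fun τ' => deriv (x j) τ') (deriv (deriv (x j)) τ) τ :=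
    (((contDiff_one_deriv (hx j)).differentiable one_ne_zero) τ).hasDerivAt
  have hc : HasDerivAt (fun τ' : ℝ => (7/4:ℝ) * τ') (7/4:ℝ) τ := by
    simpa using (hasDerivAt_id τ).const_mul (7/4:ℝ)
  have h := hc.smul hPt
  refine h.congr_deriv ?_
  rw [add_comm]

/-! ## §3 The reference form of the derivative of the switched normal defect -/

/-- **THE DERIVATIVE OF THE SWITCHED NORMAL DEFECT ALONG A UNIT-SPEED REFERENCE, REFERENCE FORM.**  For unit-speed `C²` proper filaments `x`
(`‖x_k′‖ = 1`, `c|σ| − C ≤ ‖x_k σ‖`) about which `M` is the sliced arm model (any `λ`; `0 ≤ ρ√Γ`), with `P = x_j′ τ`, `P′ = x_j″ τ`, `σ₀ = switchWeight ℓ 1 (x_j τ)`,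
`σ′ = smoothTransition′(1 − (‖x_j τ‖²/ℓ² + 1 − 2))·(−2⟪x_j τ, P⟫/ℓ²)`, `V₀ = trueField x (x_j τ)`, `V′ = D(trueField x)(x_j τ)·P`:
`(swDefect x j)′(τ) = σ′•(V₀ − ⟪V₀,P⟫P) + σ₀•(V′ − ⟪V′,P⟫P − ⟪V₀,P′⟫P − ⟪V₀,P⟫P′)` — the model drops out. [folklore] -/
theorem swDefect_hasDerivAt_ref {Rb : ℝ} (hM : SlicedModel Γ ρ lam t x M) (hρΓ : 0 ≤ ρ * Real.sqrt Γ) (hc : 0 < c)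
    (hx : ∀ k, ContDiff ℝ 2 (x k)) (hunit : ∀ k σ, ‖deriv (x k) σ‖ = 1) (hxg : ∀ k σ, c * |σ| - C ≤ ‖x k σ‖) (j : Fin N) (τ : ℝ) :
    HasDerivAt (fun τ' : ℝ => swDefect Γ Rb γ α M x j τ')
      ((deriv Real.smoothTransition (1 - (‖x j τ‖ ^ 2 / (Rb * Real.sqrt (Γ * Real.log Γ)) ^ 2 + 1 - 2 * (1:ℝ))) *
            (-(2 * ⟪x j τ, deriv (x j) τ⟫_ℝ / (Rb * Real.sqrt (Γ * Real.log Γ)) ^ 2))) •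
          (trueField Γ γ α x (x j τ) - ⟪trueField Γ γ α x (x j τ), deriv (x j) τ⟫_ℝ • deriv (x j) τ)
        + switchWeight (Rb * Real.sqrt (Γ * Real.log Γ)) 1 (x j τ) •
          (fderiv ℝ (trueField Γ γ α x) (x j τ) (deriv (x j) τ)
            - ⟪fderiv ℝ (trueField Γ γ α x) (x j τ) (deriv (x j) τ), deriv (x j) τ⟫_ℝ • deriv (x j) τ
            - ⟪trueField Γ γ α x (x j τ), deriv (deriv (x j)) τ⟫_ℝ • deriv (x j) τ
            - ⟪trueField Γ γ α x (x j τ), deriv (x j) τ⟫_ℝ • deriv (deriv (x j)) τ)) τ := by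
  set ℓ := Rb * Real.sqrt (Γ * Real.log Γ) with hℓ
  set P := deriv (x j) τ with hPdef
  set P' := deriv (deriv (x j)) τ with hP'def
  set V₀ := trueField Γ γ α x (x j τ) with hV₀
  set V' := fderiv ℝ (trueField Γ γ α x) (x j τ) P with hV'
  set σ₀ := switchWeight ℓ 1 (x j τ) with hσ₀
  set σ' := deriv Real.smoothTransition (1 - (‖x j τ‖ ^ 2 / ℓ ^ 2 + 1 - 2 * (1:ℝ))) * (-(2 * ⟪x j τ, P⟫_ℝ / ℓ ^ 2)) with hσ'
  have hx1' : ∀ k, ContDiff ℝ 1 (x k) := fun k => (hx k).of_le (by norm_num)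
  have hx1 : ∀ k σ, ‖deriv (x k) σ‖ ≤ 1 := fun k σ => (hunit k σ).le
  -- unit speed: ‖P‖ = 1, ⟪P, P'⟫ = 0
  have hP1 : ‖P‖ = 1 := hunit j τ
  have hPP' : ⟪P, P'⟫_ℝ = 0 := by
    rw [hPdef, hP'def, real_inner_comm]; exact inner_deriv_deriv_deriv_eq_zero (hx j) (hunit j) τ
  -- the pieces along the reference
  have hp : HasDerivAt (x j) P τ := (((hx j).differentiable (by norm_num)) τ).hasDerivAt
  have hPt : HasDerivAt (fun τ' => deriv (x j) τ') P' τ :=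
    (((contDiff_one_deriv (hx j)).differentiable one_ne_zero) τ).hasDerivAt
  have hσ : HasDerivAt (fun τ' => switchWeight ℓ 1 (x j τ')) σ' τ := hasDerivAt_switchWeight_comp hp
  have hV : HasDerivAt (fun τ' => trueField Γ γ α x (x j τ')) V' τ := hasDerivAt_trueField_comp hc hx1' hx1 hxg hp
  have hMs : HasDerivAt (fun τ' => M (x j τ')) ((7/4:ℝ) • P + ((7/4:ℝ) * τ) • P') τ := hasDerivAt_slicedModel_ref hM hρΓ hx j τ
  have hMτ : M (x j τ) = ((7/4:ℝ) * τ) • P := hM.apply_ref hρΓ j τ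
  -- the switched field S and its derivative
  have hS0 := (hσ.smul hV).add (((hasDerivAt_const τ (1:ℝ)).sub hσ).smul hMs)
  have hS : HasDerivAt (fun τ' => switchWeight ℓ 1 (x j τ') • trueField Γ γ α x (x j τ') + (1 - switchWeight ℓ 1 (x j τ')) • M (x j τ')) _ τ :=
    hS0.congr_of_eventuallyEq (Eventually.of_forall fun s => by simp only [Pi.add_apply, Pi.smul_apply', Pi.sub_apply])
  -- the normal part along the unit-speed frame
  have hD := hasDerivAt_perp_unitSpeed hS hPt hP1 hPP'
  have hfun : (fun τ' : ℝ => swDefect Γ Rb γ α M x j τ') = fun τ' =>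
      (switchWeight ℓ 1 (x j τ') • trueField Γ γ α x (x j τ') + (1 - switchWeight ℓ 1 (x j τ')) • M (x j τ'))
        - (⟪switchWeight ℓ 1 (x j τ') • trueField Γ γ α x (x j τ') + (1 - switchWeight ℓ 1 (x j τ')) • M (x j τ'), deriv (x j) τ'⟫_ℝ
            / ‖deriv (x j) τ'‖ ^ 2) • deriv (x j) τ' := by
    funext τ'; simp only [swDefect, switchedField, hℓ]
  rw [hfun]
  refine hD.congr_deriv ?_
  -- algebra: the model drops out
  have hPP : ⟪P, P⟫_ℝ = 1 := by rw [real_inner_self_eq_norm_sq, hP1, one_pow]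
  have hP'P : ⟪P', P⟫_ℝ = 0 := by rw [real_inner_comm]; exact hPP'
  simp only [hMτ, ← hPdef, Pi.sub_apply, inner_add_left, real_inner_smul_left, hPP, hPP', hP'P]
  module

/-! ## §4 The size of `σ′` on the collar -/

/-- `smoothTransition′` is bounded: `∃ Cφ ≥ 0, ∀ r, |smoothTransition′ r| ≤ Cφ` (from the global Lipschitz bound `…LiaLipschitzTools.exists_smoothTransition_lipschitz`).
[folklore] -/
theorem abs_deriv_smoothTransition_le : ∃ Cφ : ℝ, 0 ≤ Cφ ∧ ∀ r : ℝ, |deriv Real.smoothTransition r| ≤ Cφ := by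
  obtain ⟨Cφ, hC0, hlip⟩ := exists_smoothTransition_lipschitz
  refine ⟨Cφ, hC0, fun r => ?_⟩
  have h := norm_deriv_le_of_lip' (f := Real.smoothTransition) (x₀ := r) hC0
    (Eventually.of_forall fun y => by
      rw [Real.norm_eq_abs, Real.norm_eq_abs]; exact hlip y r)
  simpa [Real.norm_eq_abs] using h

/-- **On the collar `‖x_j τ‖² ≤ 2ℓ²` (`ℓ > 0`, `‖P‖ ≤ 1`) the derivative of the switch weight along the reference is `O(1/ℓ)`:**
`|σ′| · ℓ ≤ 2√2 · Cφ`. [folklore] -/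
theorem abs_switchWeight_deriv_mul_le {Cφ ℓ : ℝ} (hCφ : ∀ r : ℝ, |deriv Real.smoothTransition r| ≤ Cφ) (hC0 : 0 ≤ Cφ) (hℓ : 0 < ℓ)
    {y P : EuclideanSpace ℝ (Fin 3)} (hy : ‖y‖ ^ 2 ≤ 2 * ℓ ^ 2) (hP : ‖P‖ ≤ 1) (a : ℝ) :
    |deriv Real.smoothTransition a * (-(2 * ⟪y, P⟫_ℝ / ℓ ^ 2))| * ℓ ≤ 2 * Real.sqrt 2 * Cφ := by
  have hyn : ‖y‖ ≤ Real.sqrt 2 * ℓ := by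
    have h := Real.sqrt_le_sqrt hy
    rwa [Real.sqrt_sq (norm_nonneg _), Real.sqrt_mul (by norm_num : (0:ℝ) ≤ 2), Real.sqrt_sq hℓ.le] at h
  have hin : |⟪y, P⟫_ℝ| ≤ Real.sqrt 2 * ℓ := by
    refine (abs_real_inner_le_norm y P).trans ?_
    calc ‖y‖ * ‖P‖ ≤ Real.sqrt 2 * ℓ * 1 := mul_le_mul hyn hP (norm_nonneg _) (by positivity)
      _ = Real.sqrt 2 * ℓ := mul_one _
  rw [abs_mul, abs_neg, abs_div, abs_of_pos (by positivity : (0:ℝ) < ℓ ^ 2), abs_mul, abs_of_pos (by norm_num : (0:ℝ) < 2)]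
  have hℓ2 : (0:ℝ) < ℓ ^ 2 := by positivity
  calc |deriv Real.smoothTransition a| * (2 * |⟪y, P⟫_ℝ| / ℓ ^ 2) * ℓ
      ≤ Cφ * (2 * (Real.sqrt 2 * ℓ) / ℓ ^ 2) * ℓ := by
        gcongr
        · exact hCφ a
    _ = 2 * Real.sqrt 2 * Cφ := by field_simp

end Summit.NavierStokesRegularity.NavierStokesRegularity.Theorems.SkeletonJ1RFrame

end
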